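import Summits.BirchSwinnertonDyer.BirchSwinnertonDyer.Theorems.UniversalToricDescentStrictPlaceGrowthInputs
import Summits.BirchSwinnertonDyer.BirchSwinnertonDyer.Theorems.UniversalToricDescentLayerRelaxedGrowth
import Summits.BirchSwinnertonDyer.BirchSwinnertonDyer.Theorems.UniversalToricDescentLayerFixedPoints
import Summits.BirchSwinnertonDyer.BirchSwinnertonDyer.Theorems.UniversalToricDescentComplexPlaceH1
import Summits.BirchSwinnertonDyer.BirchSwinnertonDyer.Theorems.UniversalToricDescentLayerDegreeCertificate
import HarnessLib

/-!
# The weak-Leopoldt lower count inside `Sel^{Σ}_{v₀}(K_∞, E[p^∞])` with constants `1`: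
# `p^{k·pⁿ·[K:ℚ]} ≤ #{s | p^k s = 0, conj_{γ^{pⁿ}} s = s}` (crux ♭T≤ stmt-BirchSwinnertonDyer-23042, line `sigmacongruence`,
# stub TS1′ `stub_twinStrictSurj`, assembly (1e) — the `hY` input of p645087)

Route `UniversalToricDescent`, lead prover `bsd-wall-utd-p1` g16. THEOREMS ONLY (no definition, no named fact, no `sorry`);
`--supports stmt-BirchSwinnertonDyer-23042`. BSD is not proved by any of this.

p648146 (`exists_finset_selmerAc_torsion_invariant_card_ge`) produces, from Poitou–Tate over the layer `K_n` and the injectivity of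
`H¹(K_n, E[p^∞]) → H¹(K_∞, E[p^∞])`, a finite `F ⊆ Sel^{Σ}_{v₀}(K_∞, E[p^∞])` of `p^k`-torsion classes fixed by `Γ_{K_n}` with
`p^{k pⁿ [K:ℚ]} ≤ c(n) · #F`. Here the constant is evaluated: `c(n) = 1` when `E(K_∞)[p^∞] = 0` (`…LayerFixedPoints`) and `K` is
totally complex (`…ComplexPlaceH1`, layers are totally complex), the injectivity holds (`…LayerDegreeCertificate`), and `F` is counted
inside the (finite, `…StrictPlaceGrowthInputs`) set of `p^k`-torsion classes fixed by `conj_{γ^{pⁿ}}`.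

* `prime_pow_le_natCard_pTorsion_pow_conjH1_pow_fixed`.

References: [GreenbergLNM1716] Thm 1.7, §3 Lemma 3.1 (p. 86–87); [GreenbergVatsal2000] §2 Prop. (2.1); [MilneADT2006] I Thm. 4.10.
-/

set_option autoImplicit false
-- the Theorems namespace of this sub repeats the summit name by design (D-0017 nested layout)
set_option linter.dupNamespace false

noncomputable section

open scoped Classical

namespace Summit.BirchSwinnertonDyer.BirchSwinnertonDyer.Theorems.UniversalToricDescentStrictPlaceGrowth

open Function Field NumberField IsDedekindDomain WeierstrassCurve
open Literature.NumberTheory.GaloisRepresentations Literature.NumberTheory.EllipticCurves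
  Literature.NumberTheory.EllipticCurves.GreenbergSelmer Literature.NumberTheory.GaloisCohomology
  Summit.BirchSwinnertonDyer.Rank1Residual Summit.BirchSwinnertonDyer.Rank1Residual.X11b
  Summit.BirchSwinnertonDyer.Rank1Residual.X11b.Coinv Summit.BirchSwinnertonDyer.Rank1Residual.X11b.AcSelmer
  Summit.BirchSwinnertonDyer.BirchSwinnertonDyer.Theorems.UniversalToricDescentLayerRelaxedGrowth
  Summit.BirchSwinnertonDyer.BirchSwinnertonDyer.Theorems.UniversalToricDescentLayerFixedPoints
  Summit.BirchSwinnertonDyer.BirchSwinnertonDyer.Theorems.UniversalToricDescentComplexPlaceH1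
  Summit.BirchSwinnertonDyer.BirchSwinnertonDyer.Theorems.UniversalToricDescentLayerDegreeCertificate

variable {K : Type} [Field K] [NumberField K] (W : WeierstrassCurve K) [W.IsElliptic] (p : ℕ)
  [Fact p.Prime] (κ : ZpExtension K p)

/-- **`p^{k·pⁿ·[K:ℚ]} ≤ #{s ∈ Sel^{Σ}_{v₀}(K_∞, E[p^∞]) | p^k s = 0, conj_{γ^{pⁿ}} s = s}`** for `K` totally complex, `E(K_∞)[p^∞] = 0`,
Poitou–Tate over `K_n`, `Σ` finite, `v₀ ∤ p`: p648146 with both constants equal to `1`.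
[cite: GreenbergLNM1716, Thm 1.7 and §3 Lemma 3.1 (p. 86)] [cite: GreenbergVatsal2000, §2 Prop. (2.1)] -/
theorem prime_pow_le_natCard_pTorsion_pow_conjH1_pow_fixed [IsTotallyComplex K] {n : ℕ}
    (hPT : poitouTate_selmerStructure_duality (κ.layer n))
    (hB : FixedPoints.addSubgroup κ.kerSubgroup (W.geomPrimaryTorsion p) = ⊥)
    {γ : absoluteGaloisGroup K} (hγ : κ.IsTopGenerator γ) (v₀ : HeightOneSpectrum (𝓞 K))
    (hv₀ : ((p : ℕ) : 𝓞 K) ∉ v₀.asIdeal) {S : Set (HeightOneSpectrum (𝓞 K))} (hS : S.Finite) (k : ℕ) :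
    p ^ (k * (p ^ n * Module.finrank ℚ K)) ≤ Nat.card {s : selmerAc W p κ v₀ S //
      p ^ k • s = 0 ∧ W.conjH1 p κ.kerSubgroup (γ ^ p ^ n) (s : W.subgroupH1 p κ.kerSubgroup) = s} := by
  haveI : IsTotallyComplex (κ.layer n) := isTotallyComplex_of_algebra K (κ.layer n)
  haveI hfinT : Finite {s : selmerAc W p κ v₀ S //
      p ^ k • s = 0 ∧ W.conjH1 p κ.kerSubgroup (γ ^ p ^ n) (s : W.subgroupH1 p κ.kerSubgroup) = s} :=
    (finite_pTorsion_pow_conjH1_pow_fixed W p κ hγ v₀ hS n k).to_subtype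
  obtain ⟨F, hF, hcard⟩ := exists_finset_selmerAc_torsion_invariant_card_ge W p κ v₀ hv₀ S n k hPT
    (layerToInfty_injective_of_fixedPoints_eq_bot W p κ hγ hB n)
  have hγn : γ ^ p ^ n ∈ κ.layerSubgroup n := by
    have hγ' : κ γ = Multiplicative.ofAdd 1 := hγ
    rw [ZpExtension.mem_layerSubgroup, map_pow, hγ', ← ofAdd_nsmul, toAdd_ofAdd, nsmul_eq_mul, mul_one, Nat.cast_pow]
  rw [natCard_fixed_baseChange_layer_eq_one W p κ hB n, prod_natCard_localH1_localGaloisModule_eq_one, one_mul, one_mul] at hcard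
  have hsub : ∀ s ∈ F, p ^ k • s = 0 ∧ W.conjH1 p κ.kerSubgroup (γ ^ p ^ n) (s : W.subgroupH1 p κ.kerSubgroup) = s :=
    fun s hs ↦ ⟨(hF s hs).1, (hF s hs).2 _ hγn⟩
  refine hcard.trans ?_
  rw [← Fintype.card_coe, ← Nat.card_eq_fintype_card]
  exact Nat.card_le_card_of_injective (fun x : F ↦ (⟨x.1, hsub x.1 x.2⟩ : {s : selmerAc W p κ v₀ S //
      p ^ k • s = 0 ∧ W.conjH1 p κ.kerSubgroup (γ ^ p ^ n) (s : W.subgroupH1 p κ.kerSubgroup) = s}))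
    fun x y h ↦ Subtype.ext (congrArg (fun z : {s : selmerAc W p κ v₀ S //
      p ^ k • s = 0 ∧ W.conjH1 p κ.kerSubgroup (γ ^ p ^ n) (s : W.subgroupH1 p κ.kerSubgroup) = s} ↦ (z : selmerAc W p κ v₀ S)) h)

end Summit.BirchSwinnertonDyer.BirchSwinnertonDyer.Theorems.UniversalToricDescentStrictPlaceGrowth

end
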